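import Summits.BirchSwinnertonDyer.BirchSwinnertonDyer.Theorems.PrintCf2SplitBadTwoRestrictedSelmerCokernelOfLocSurj
import Summits.BirchSwinnertonDyer.BirchSwinnertonDyer.Theorems.PrintCf2SplitBadTwoRestrictedSelmerCokernelExactOfFrame
import Summits.BirchSwinnertonDyer.BirchSwinnertonDyer.Theorems.PrintCf2SplitBadTwoFirstLayerInertAtSeven
import HarnessLib

/-!
# Crux `PrintCf2.SplitBadTwoRankOneOfFacts` (stmt-BirchSwinnertonDyer-20368), road α v10.3 — S3c residual (R-SURJ), file 4b:
# (R-SURJ′) «`[𝔖^Γ : res 𝔖_{v̄}(K, W*)] · 2 = (∏_{w∈T} #LK_w) · #LK_{v̄}`» and cut 7's (R-SURJ″) with `e_s ≡ −1`, FROM (LS), on every S3c frame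

Cell `bsd-print-cf2`, width seat `bsd-line-cf2-p1-w5` g3 (prover-bsd-line-cf2-p1-w5-g3-0); lane «(R-SURJ)». `--supports stmt-BirchSwinnertonDyer-20368`
(helper, Theses-free). HONEST FRAMING: nothing here closes the crux or a registered stub; BSD is not proved by any of this; no summit statement is proved
by this seat. No definition, no named fact, no `sorry`. CONDITIONAL on the displayed hypothesis (LS) (-w4 g9, p668156; LEAD g12 ruling 21:04:53Z «the
single XL residual of S3c»), nothing else.

WHAT (road α, `W* = ↥((W.baseChange K).endEigenPrimaryTorsion 2 π r)`; frames: member `C • W = cm7^{(d)}`, `K` imaginary quadratic, `v ≠ v̄` over `2`,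
`π² = π − 2`, `r² = r − 2`, `κ'` unramified outside `v̄` with generator `γ'`, `T = {w : 2 ∉ w, 7d ∈ w}`):
* `index_lifts_of_frame_eq_prod_of_locSurj` — «δ = 1»: (LS) ⟹ `[A : 𝔖_{v̄}(K, W*)] = (∏_{w∈T} #LK_w) · #LK_{v̄}` (file 4a + the frame's vanishing local
  kernels off `T`, -w3 g7, and at infinity, LEAD g11);
* **`relIndex_mul_two_control_of_frame_eq_prod_of_locSurj`** — (R-SURJ′): (LS) ⟹ `[𝔖^Γ : res 𝔖] · 2 = (∏_{w∈T} #LK_w) · #LK_{v̄}` (file 3's exact cokernel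
  + -w6 g2's UNCONDITIONAL `#ker(control) = 1`, `natCard_ker_control_of_frame_eq_one_unconditional`);
* `padicValNat_relIndex_control_of_frame_of_locSurj` — `v₂ relIndex = Σ_{w∈T} v₂ #LK_w + v₂ #LK_{v̄} − 1`;
* **`rSurj''_of_locSurj`** — cut 7's displayed (R-SURJ″) (`hSurj` of `restrictedControl_two_of_four_residuals'`, p668543) VERBATIM with `es := −1`, from
  (LS) quantified over the frames (`hLSall`) — the SAME statement that gives (R-TOP′) via -w4 g9's `natCard_endCoinvariants_eq_one_of_frame_of_locSurj`.
So after this file the four residuals of cut 7 read: (R-TOP′) ⟸ (LS) + hfinB′ + facts [-w4 g9], (R-SURJ″) ⟸ (LS) [this file], (R-DYADIC) [-w2 g9],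
(R-BV) [-w7]. presearch: as file 4a; no new fact. beyond-print theorem: no.

References: [Agboola2007] §3 Prop. 3.2, §6; [GreenbergLNM1716] §3 Lemmas 3.1–3.3; [JetchevSkinnerWan2017] Lemma 3.3.3, Prop. 3.3.2.
-/

noncomputable section

open scoped Classical

set_option linter.dupNamespace false
set_option autoImplicit false

open NumberField IsDedekindDomain Field
open Literature.NumberTheory.EllipticCurves Literature.NumberTheory.EllipticCurves.GreenbergSelmer
open Literature.NumberTheory.EllipticCurves.Agboola2007
open Literature.NumberTheory.EllipticCurves.IwasawaDual
open Literature.NumberTheory.EllipticCurves.ResKernel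
open Literature.NumberTheory.GaloisRepresentations

namespace Summit.BirchSwinnertonDyer.BirchSwinnertonDyer.Theorems.PrintCf2.RestrictedSelmerPair

/-! ## §2. Road α: (R-SURJ′) and cut 7's (R-SURJ″) with `e_s ≡ −1` FROM (LS) on every S3c frame -/

section Frame

open WeierstrassCurve
open Summit.BirchSwinnertonDyer.BirchSwinnertonDyer.Theorems.PrintCf2.AdditiveAtSeven
open Summit.BirchSwinnertonDyer.BirchSwinnertonDyer.Theorems.GoldfeldGoodTwists

variable {K : Type} [Field K] [NumberField K]

/-- `v_p (∏_{i ∈ s} f i) = Σ_{i ∈ s} v_p (f i)` when no factor vanishes. [folklore] -/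
private theorem padicValNat_finset_prod_locSurj {ι : Type*} (p : ℕ) [Fact p.Prime] (s : Finset ι) (f : ι → ℕ)
    (hf : ∀ i ∈ s, f i ≠ 0) : padicValNat p (∏ i ∈ s, f i) = ∑ i ∈ s, padicValNat p (f i) := by
  induction s using Finset.induction_on with
  | empty => simp
  | insert a s ha ih =>
    rw [Finset.prod_insert ha, Finset.sum_insert ha,
      padicValNat.mul (hf a (Finset.mem_insert_self a s))
        (Finset.prod_ne_zero_iff.mpr fun i hi ↦ hf i (Finset.mem_insert_of_mem hi)),
      ih fun i hi ↦ hf i (Finset.mem_insert_of_mem hi)]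

/-- **«δ = 1» ON AN S3c FRAME FROM (LS): `[A : 𝔖_{v̄}(K, W*)] = (∏_{w∈T} #LK_w) · #LK_{v̄}`** (member `C • W = cm7^{(d)}`, `d ≠ 0`, `K` imaginary
quadratic, `v̄ ∣ 2`, `π² = π − 2`, `r² = r − 2`, `κ'` unramified outside `v̄`, any `γ'`, `T = {w : 2 ∉ w, 7d ∈ w}`), GRANTED the level-`K` local
surjectivity (LS) for `W* = ↥((W.baseChange K).endEigenPrimaryTorsion 2 π r)` at the strict place `v̄` (-w4 g9's displayed hypothesis, p668156;
dual obstruction `H¹_{str v}(K, T_v W)`). §1 with the frame's local values (local kernels vanish at the good odd places, -w3 g7; archimedean ones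
vanish, LEAD g11). [cite: GreenbergLNM1716, §3 Lemmas 3.2–3.3] [cite: JetchevSkinnerWan2017, Prop. 3.3.2] [cite: Agboola2007, §3 Prop. 3.2] -/
theorem index_lifts_of_frame_eq_prod_of_locSurj {d : ℤ} (hd0 : d ≠ 0)
    (W : WeierstrassCurve ℚ) [W.IsElliptic] (C : VariableChange ℚ) (hC : C • W = cm7.quadraticTwist (d : ℚ))
    (hK : IsImaginaryQuadratic K) (vbar : HeightOneSpectrum (𝓞 K)) (hvbar : ((2 : ℕ) : 𝓞 K) ∈ vbar.asIdeal)
    (π : (W.baseChange K).endRing) (hrel : (π : AddMonoid.End (W.baseChange K).geomPoints) * π = π - 2) {r : ℤ_[2]} (hr : r * r = r - 2)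
    (κ' : ZpExtension K 2) (hκ' : κ'.IsUnramifiedOutside vbar) (γ' : absoluteGaloisGroup K)
    (T : Finset (HeightOneSpectrum (𝓞 K)))
    (hT : ∀ w : HeightOneSpectrum (𝓞 K), w ∈ T ↔ ((2 : ℕ) : 𝓞 K) ∉ w.asIdeal ∧ ((7 * d : ℤ) : 𝓞 K) ∈ w.asIdeal)
    (hLS : ∀ (S : Finset (HeightOneSpectrum (𝓞 K))), (∀ w ∈ S, ((2 : ℕ) : 𝓞 K) ∉ w.asIdeal ∨ w = vbar) →
      ∀ τ : (w : HeightOneSpectrum (𝓞 K)) → subgroupH1 (decomp (K := K) w) ↥((W.baseChange K).endEigenPrimaryTorsion 2 π r),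
      ∃ g : discreteH1 (absoluteGaloisGroup K) ↥((W.baseChange K).endEigenPrimaryTorsion 2 π r),
        (∀ w ∈ S, ResKernel.resSubgroup (decomp (K := K) w) ↥((W.baseChange K).endEigenPrimaryTorsion 2 π r) g = τ w) ∧
        (∀ w : HeightOneSpectrum (𝓞 K), w ∉ S → ((2 : ℕ) : 𝓞 K) ∉ w.asIdeal →
          ResKernel.resSubgroup (decomp (K := K) w) ↥((W.baseChange K).endEigenPrimaryTorsion 2 π r) g = 0)) :
    ((restrictedSelmerBase ↥((W.baseChange K).endEigenPrimaryTorsion 2 π r) 2 vbar).addSubgroupOf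
        (((endInvariants (conjRestricted κ' ↥((W.baseChange K).endEigenPrimaryTorsion 2 π r) vbar γ' - 1)).map
          (restrictedSelmerZp κ' ↥((W.baseChange K).endEigenPrimaryTorsion 2 π r) vbar).subtype).comap
          (resOfLe ↥((W.baseChange K).endEigenPrimaryTorsion 2 π r) (le_top : κ'.kerSubgroup ≤ ⊤)))).index =
      (∏ w ∈ T, Nat.card (resOfLe ↥((W.baseChange K).endEigenPrimaryTorsion 2 π r)
          (inf_le_inf_right (decomp w) (le_top : κ'.kerSubgroup ≤ ⊤))).ker) *
        Nat.card (resOfLe ↥((W.baseChange K).endEigenPrimaryTorsion 2 π r)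
          (inf_le_inf_right (decomp vbar) (le_top : κ'.kerSubgroup ≤ ⊤))).ker := by
  haveI : IsTotallyComplex K := hK.2
  set M := ↥((W.baseChange K).endEigenPrimaryTorsion 2 π r) with hM
  have hTp : ∀ w ∈ T, ((2 : ℕ) : 𝓞 K) ∉ w.asIdeal := fun w hw ↦ ((hT w).mp hw).1
  have hT0 : ∀ w : HeightOneSpectrum (𝓞 K), ((2 : ℕ) : 𝓞 K) ∉ w.asIdeal → w ∉ T →
      (resOfLe M (inf_le_inf_right (decomp w) (le_top : κ'.kerSubgroup ≤ ⊤))).ker = ⊥ := by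
    intro w h2w hwT
    have h7d : ((7 * d : ℤ) : 𝓞 K) ∉ w.asIdeal := fun h ↦ hwT ((hT w).mpr ⟨h2w, h⟩)
    exact localKer_top_of_frame_eq_bot hd0 W C hC vbar hvbar π hrel hr κ' hκ' h2w h7d
  exact index_lifts_eq_prod_natCard_localKer_of_locSurj κ' M vbar γ' hvbar T hTp hT0
    (localKer_decompInf_eq_bot_of_isImaginaryQuadratic κ' M hK)
    (fun y _ _ ↦ locSurj_top_of_locSurj κ' M vbar hvbar hLS T hTp y)

/-- **(R-SURJ′) ON EVERY S3c FRAME FROM (LS): `[𝔖^Γ : res 𝔖_{v̄}(K, W*)] · 2 = (∏_{w∈T} #LK_w) · #LK_{v̄}`** — file 3/3's exact cokernel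
`relIndex · 2 = [A : 𝔖] · #ker(control)`, -w6 g2's UNCONDITIONAL `#ker(control) = 1` (`natCard_ker_control_of_frame_eq_one_unconditional`, (H7) a theorem),
and «δ = 1» from (LS). Binders: member, `K` imaginary quadratic, `v ≠ v̄` over `2`, `π, r`, `κ'` unramified outside `v̄` with generator `γ'`, `T`.
[cite: Agboola2007, §3 Prop. 3.2, §6] [cite: GreenbergLNM1716, §3 Lemmas 3.1–3.3] [cite: JetchevSkinnerWan2017, Prop. 3.3.2] -/
theorem relIndex_mul_two_control_of_frame_eq_prod_of_locSurj {d : ℤ} (hd0 : d ≠ 0)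
    (W : WeierstrassCurve ℚ) [W.IsElliptic] (C : VariableChange ℚ) (hC : C • W = cm7.quadraticTwist (d : ℚ))
    (hK : IsImaginaryQuadratic K) {v vbar : HeightOneSpectrum (𝓞 K)} (hv : ((2 : ℕ) : 𝓞 K) ∈ v.asIdeal)
    (hvbar : ((2 : ℕ) : 𝓞 K) ∈ vbar.asIdeal) (hne : vbar ≠ v) (π : (W.baseChange K).endRing)
    (hrel : (π : AddMonoid.End (W.baseChange K).geomPoints) * π = π - 2) {r : ℤ_[2]} (hr : r * r = r - 2)
    (κ' : ZpExtension K 2) (hκ' : κ'.IsUnramifiedOutside vbar) {γ' : absoluteGaloisGroup K} (hγ' : κ'.IsTopGenerator γ')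
    (T : Finset (HeightOneSpectrum (𝓞 K)))
    (hT : ∀ w : HeightOneSpectrum (𝓞 K), w ∈ T ↔ ((2 : ℕ) : 𝓞 K) ∉ w.asIdeal ∧ ((7 * d : ℤ) : 𝓞 K) ∈ w.asIdeal)
    (hLS : ∀ (S : Finset (HeightOneSpectrum (𝓞 K))), (∀ w ∈ S, ((2 : ℕ) : 𝓞 K) ∉ w.asIdeal ∨ w = vbar) →
      ∀ τ : (w : HeightOneSpectrum (𝓞 K)) → subgroupH1 (decomp (K := K) w) ↥((W.baseChange K).endEigenPrimaryTorsion 2 π r),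
      ∃ g : discreteH1 (absoluteGaloisGroup K) ↥((W.baseChange K).endEigenPrimaryTorsion 2 π r),
        (∀ w ∈ S, ResKernel.resSubgroup (decomp (K := K) w) ↥((W.baseChange K).endEigenPrimaryTorsion 2 π r) g = τ w) ∧
        (∀ w : HeightOneSpectrum (𝓞 K), w ∉ S → ((2 : ℕ) : 𝓞 K) ∉ w.asIdeal →
          ResKernel.resSubgroup (decomp (K := K) w) ↥((W.baseChange K).endEigenPrimaryTorsion 2 π r) g = 0)) :
    (((restrictedSelmerBase ↥((W.baseChange K).endEigenPrimaryTorsion 2 π r) 2 vbar).map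
        (resOfLe ↥((W.baseChange K).endEigenPrimaryTorsion 2 π r) (le_top : κ'.kerSubgroup ≤ ⊤))).addSubgroupOf
        (restrictedSelmerZp κ' ↥((W.baseChange K).endEigenPrimaryTorsion 2 π r) vbar)).relIndex
      (endInvariants (conjRestricted κ' ↥((W.baseChange K).endEigenPrimaryTorsion 2 π r) vbar γ' - 1)) * 2 =
      (∏ w ∈ T, Nat.card (resOfLe ↥((W.baseChange K).endEigenPrimaryTorsion 2 π r)
          (inf_le_inf_right (decomp w) (le_top : κ'.kerSubgroup ≤ ⊤))).ker) *
        Nat.card (resOfLe ↥((W.baseChange K).endEigenPrimaryTorsion 2 π r)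
          (inf_le_inf_right (decomp vbar) (le_top : κ'.kerSubgroup ≤ ⊤))).ker := by
  rw [two_mul_relIndex_control_of_frame_eq hd0 W C hC hK vbar hvbar π hrel hr κ' hκ' hγ',
    (natCard_ker_control_of_frame_eq_one_unconditional hd0 W C hC hK v vbar hv hvbar hne π hrel hr κ' hκ').1, mul_one]
  exact index_lifts_of_frame_eq_prod_of_locSurj hd0 W C hC hK vbar hvbar π hrel hr κ' hκ' γ' T hT hLS

/-- **`v₂ [𝔖^Γ : res 𝔖_{v̄}(K, W*)] = Σ_{w∈T} v₂ #LK_w + v₂ #LK_{v̄} − 1` ON EVERY S3c FRAME FROM (LS)** — the valuation form of (R-SURJ′)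
(the local kernels are finite and non-empty, so the product is non-zero). [cite: Agboola2007, §3 Prop. 3.2, §6] [cite: GreenbergLNM1716, §3] -/
theorem padicValNat_relIndex_control_of_frame_of_locSurj {d : ℤ} (hd0 : d ≠ 0) (hsq : Squarefree d)
    (W : WeierstrassCurve ℚ) [W.IsElliptic] (C : VariableChange ℚ) (hC : C • W = cm7.quadraticTwist (d : ℚ))
    (hK : IsImaginaryQuadratic K) {v vbar : HeightOneSpectrum (𝓞 K)} (hv : ((2 : ℕ) : 𝓞 K) ∈ v.asIdeal)
    (hvbar : ((2 : ℕ) : 𝓞 K) ∈ vbar.asIdeal) (hne : vbar ≠ v) (π : (W.baseChange K).endRing)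
    (hrel : (π : AddMonoid.End (W.baseChange K).geomPoints) * π = π - 2) {r : ℤ_[2]} (hr : r * r = r - 2)
    (κ' : ZpExtension K 2) (hκ' : κ'.IsUnramifiedOutside vbar) {γ' : absoluteGaloisGroup K} (hγ' : κ'.IsTopGenerator γ')
    (T : Finset (HeightOneSpectrum (𝓞 K)))
    (hT : ∀ w : HeightOneSpectrum (𝓞 K), w ∈ T ↔ ((2 : ℕ) : 𝓞 K) ∉ w.asIdeal ∧ ((7 * d : ℤ) : 𝓞 K) ∈ w.asIdeal)
    (hLS : ∀ (S : Finset (HeightOneSpectrum (𝓞 K))), (∀ w ∈ S, ((2 : ℕ) : 𝓞 K) ∉ w.asIdeal ∨ w = vbar) →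
      ∀ τ : (w : HeightOneSpectrum (𝓞 K)) → subgroupH1 (decomp (K := K) w) ↥((W.baseChange K).endEigenPrimaryTorsion 2 π r),
      ∃ g : discreteH1 (absoluteGaloisGroup K) ↥((W.baseChange K).endEigenPrimaryTorsion 2 π r),
        (∀ w ∈ S, ResKernel.resSubgroup (decomp (K := K) w) ↥((W.baseChange K).endEigenPrimaryTorsion 2 π r) g = τ w) ∧
        (∀ w : HeightOneSpectrum (𝓞 K), w ∉ S → ((2 : ℕ) : 𝓞 K) ∉ w.asIdeal →
          ResKernel.resSubgroup (decomp (K := K) w) ↥((W.baseChange K).endEigenPrimaryTorsion 2 π r) g = 0)) :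
    (padicValNat 2 ((((restrictedSelmerBase ↥((W.baseChange K).endEigenPrimaryTorsion 2 π r) 2 vbar).map
        (resOfLe ↥((W.baseChange K).endEigenPrimaryTorsion 2 π r) (le_top : κ'.kerSubgroup ≤ ⊤))).addSubgroupOf
        (restrictedSelmerZp κ' ↥((W.baseChange K).endEigenPrimaryTorsion 2 π r) vbar)).relIndex
      (endInvariants (conjRestricted κ' ↥((W.baseChange K).endEigenPrimaryTorsion 2 π r) vbar γ' - 1))) : ℤ) =
    (∑ w ∈ T, padicValNat 2 (Nat.card (resOfLe ↥((W.baseChange K).endEigenPrimaryTorsion 2 π r) (inf_le_inf_right (decomp w) (le_top : κ'.kerSubgroup ≤ ⊤))).ker) : ℕ) +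
      padicValNat 2 (Nat.card (resOfLe ↥((W.baseChange K).endEigenPrimaryTorsion 2 π r) (inf_le_inf_right (decomp vbar) (le_top : κ'.kerSubgroup ≤ ⊤))).ker) +
      (-1 : ℤ) := by
  have heq := relIndex_mul_two_control_of_frame_eq_prod_of_locSurj hd0 W C hC hK hv hvbar hne π hrel hr κ' hκ' hγ' T hT hLS
  have hT0 : ∀ w ∈ T, Nat.card (resOfLe ↥((W.baseChange K).endEigenPrimaryTorsion 2 π r)
      (inf_le_inf_right (decomp w) (le_top : κ'.kerSubgroup ≤ ⊤))).ker ≠ 0 := by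
    intro w hw
    obtain ⟨h2w, h7d⟩ := (hT w).mp hw
    haveI := (finite_and_natCard_localKer_top_of_frame_le_two hd0 hsq W C hC hK vbar hvbar π hrel hr κ' hκ' h2w h7d).1
    exact Nat.card_pos.ne'
  have hvbar0 : Nat.card (resOfLe ↥((W.baseChange K).endEigenPrimaryTorsion 2 π r)
      (inf_le_inf_right (decomp vbar) (le_top : κ'.kerSubgroup ≤ ⊤))).ker ≠ 0 := by
    haveI := (finite_and_natCard_localKer_top_vbar_of_frame_le_four hd0 W C hC hK hv hvbar hne π hrel hr κ').1
    exact Nat.card_pos.ne'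
  have hP0 : (∏ w ∈ T, Nat.card (resOfLe ↥((W.baseChange K).endEigenPrimaryTorsion 2 π r)
      (inf_le_inf_right (decomp w) (le_top : κ'.kerSubgroup ≤ ⊤))).ker) ≠ 0 := Finset.prod_ne_zero_iff.mpr hT0
  set R := (((restrictedSelmerBase ↥((W.baseChange K).endEigenPrimaryTorsion 2 π r) 2 vbar).map
        (resOfLe ↥((W.baseChange K).endEigenPrimaryTorsion 2 π r) (le_top : κ'.kerSubgroup ≤ ⊤))).addSubgroupOf
        (restrictedSelmerZp κ' ↥((W.baseChange K).endEigenPrimaryTorsion 2 π r) vbar)).relIndex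
      (endInvariants (conjRestricted κ' ↥((W.baseChange K).endEigenPrimaryTorsion 2 π r) vbar γ' - 1)) with hR
  have hR0 : R ≠ 0 := by
    intro h0
    rw [h0, zero_mul] at heq
    exact mul_ne_zero hP0 hvbar0 heq.symm
  have hv := congrArg (padicValNat 2) heq
  rw [padicValNat.mul hR0 two_ne_zero, padicValNat.mul hP0 hvbar0, padicValNat_finset_prod_locSurj 2 T _ hT0,
    padicValNat.self (by norm_num : 1 < 2)] at hv
  omega

/-- **CUT 7's (R-SURJ″) (`hSurj` of `restrictedControl_two_of_four_residuals'`, p668543) VERBATIM, with `e_s ≡ −1`, FROM (LS) ON EVERY FRAME.**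
The displayed hypothesis `hLSall` is -w4 g9's (LS) (p668156, `baseLift_of_locSurj`) quantified over the frames — the ONE Poitou–Tate-shaped input
(LEAD g12 ruling 21:04:53Z: «the single XL residual of S3c = (LS)»); so (R-SURJ″) and (R-TOP′) are discharged by the same statement.
[cite: Agboola2007, §3 Prop. 3.2, §6] [cite: GreenbergLNM1716, §3 Lemmas 3.1–3.3] [cite: JetchevSkinnerWan2017, Lemma 3.3.3, Prop. 3.3.2] -/
theorem rSurj''_of_locSurj
    (hLSall : ∀ (d : ℤ), d ≠ 0 → Squarefree d → d % 4 ≠ 1 →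
      ∀ (W : WeierstrassCurve ℚ) [W.IsElliptic] (C : VariableChange ℚ), C • W = cm7.quadraticTwist (d : ℚ) →
      ∀ (K : Type) [Field K] [NumberField K], IsImaginaryQuadratic K →
      ∀ (v vbar : HeightOneSpectrum (𝓞 K)),
        ((2 : ℕ) : 𝓞 K) ∈ v.asIdeal → ((2 : ℕ) : 𝓞 K) ∈ vbar.asIdeal → vbar ≠ v →
      ∀ (π : (W.baseChange K).endRing), (π : AddMonoid.End (W.baseChange K).geomPoints) * π = π - 2 →
      ∀ (r : ℤ_[2]), r * r = r - 2 →
      ∀ (S : Finset (HeightOneSpectrum (𝓞 K))), (∀ w ∈ S, ((2 : ℕ) : 𝓞 K) ∉ w.asIdeal ∨ w = vbar) →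
      ∀ τ : (w : HeightOneSpectrum (𝓞 K)) → subgroupH1 (decomp (K := K) w) ↥((W.baseChange K).endEigenPrimaryTorsion 2 π r),
      ∃ g : discreteH1 (absoluteGaloisGroup K) ↥((W.baseChange K).endEigenPrimaryTorsion 2 π r),
        (∀ w ∈ S, ResKernel.resSubgroup (decomp (K := K) w) ↥((W.baseChange K).endEigenPrimaryTorsion 2 π r) g = τ w) ∧
        (∀ w : HeightOneSpectrum (𝓞 K), w ∉ S → ((2 : ℕ) : 𝓞 K) ∉ w.asIdeal →
          ResKernel.resSubgroup (decomp (K := K) w) ↥((W.baseChange K).endEigenPrimaryTorsion 2 π r) g = 0)) :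
    ∃ es : ℤ → ℤ → ℤ, ∀ (d : ℤ), d ≠ 0 → Squarefree d → d % 4 ≠ 1 →
      ∀ (W : WeierstrassCurve ℚ) [W.IsElliptic] [W.IsGloballyMinimal] (C : VariableChange ℚ),
        C • W = cm7.quadraticTwist (d : ℚ) → W.analyticRank = 1 →
      ∀ (K : Type) [Field K] [NumberField K], IsImaginaryQuadratic K →
      ∀ (v vbar : HeightOneSpectrum (𝓞 K)),
        ((2 : ℕ) : 𝓞 K) ∈ v.asIdeal → ((2 : ℕ) : 𝓞 K) ∈ vbar.asIdeal → vbar ≠ v →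
      ∀ (π : (W.baseChange K).endRing), (π : AddMonoid.End (W.baseChange K).geomPoints) * π = π - 2 →
      ∀ (r : ℤ_[2]), r * r = r - 2 →
        (∀ τ ∈ GreenbergSelmer.inertia v, ∀ x : ↥((W.baseChange K).endEigenPrimaryTorsion 2 π r), τ • x = x ∨ τ • x = -x) →
      ∀ (κ' : ZpExtension K 2), κ'.IsUnramifiedOutside vbar → ∀ (γ' : absoluteGaloisGroup K), κ'.IsTopGenerator γ' →
      Finite (endInvariants (conjRestricted κ' ↥((W.baseChange K).endEigenPrimaryTorsion 2 π r) vbar γ' - 1)) →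
      ∀ (T : Finset (HeightOneSpectrum (𝓞 K))),
        (∀ w : HeightOneSpectrum (𝓞 K), w ∈ T ↔ ((2 : ℕ) : 𝓞 K) ∉ w.asIdeal ∧ ((7 * d : ℤ) : 𝓞 K) ∈ w.asIdeal) →
        (padicValNat 2 ((((restrictedSelmerBase ↥((W.baseChange K).endEigenPrimaryTorsion 2 π r) 2 vbar).map
            (resOfLe ↥((W.baseChange K).endEigenPrimaryTorsion 2 π r) (le_top : κ'.kerSubgroup ≤ ⊤))).addSubgroupOf
            (restrictedSelmerZp κ' ↥((W.baseChange K).endEigenPrimaryTorsion 2 π r) vbar)).relIndex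
          (endInvariants (conjRestricted κ' ↥((W.baseChange K).endEigenPrimaryTorsion 2 π r) vbar γ' - 1))) : ℤ) =
        (∑ w ∈ T, padicValNat 2 (Nat.card (resOfLe ↥((W.baseChange K).endEigenPrimaryTorsion 2 π r) (inf_le_inf_right (decomp w) (le_top : κ'.kerSubgroup ≤ ⊤))).ker) : ℕ) +
          padicValNat 2 (Nat.card (resOfLe ↥((W.baseChange K).endEigenPrimaryTorsion 2 π r) (inf_le_inf_right (decomp vbar) (le_top : κ'.kerSubgroup ≤ ⊤))).ker) +
          es (d % 2) ((d / (2 - d % 2)) % 8) := by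
  refine ⟨fun _ _ ↦ -1, ?_⟩
  intro d hd0 hsq hd4 W _ _ C hC _ K _ _ hK v vbar hv hvbar hne π hrel r hr _ κ' hκ' γ' hγ' _ T hT
  exact padicValNat_relIndex_control_of_frame_of_locSurj hd0 hsq W C hC hK hv hvbar hne π hrel hr κ' hκ' hγ' T hT
    (hLSall d hd0 hsq hd4 W C hC K hK v vbar hv hvbar hne π hrel r hr)

end Frame

end Summit.BirchSwinnertonDyer.BirchSwinnertonDyer.Theorems.PrintCf2.RestrictedSelmerPair

end
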